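import Literature.NumberTheory.LFunctions.ConnesProlateGuessSupNorm
import HarnessLib

/-!
# Uniqueness of the prolate functions `h_{n,λ}` (Sturm's oscillation argument)

THIS IS NOT AN RH STATEMENT.  The interface `IsProlateFunction lam n f` of `ConnesProlateGuess`
characterises the prolate spheroidal wave function `h_{n,λ}` of Connes' Letter (2026, §6.3) and of
Connes–Consani–Moscovici (2025, §7 (7.5), (7.10)–(7.12)) WITHOUT ordering eigenvalues: a `C²([−λ, λ])`
solution of `−((λ² − x²) f′)′ + (2πλx)² f = χ f` on `(−λ, λ)` for SOME `χ`, with exactly `n` zeros in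
`(−λ, λ)`, `∫ f² = 1`, `f(0) > 0`, `f = 0` off `[−λ, λ]`.  We prove that these axioms determine `f`:

* `IsProlateFunction.unique : IsProlateFunction lam n f → IsProlateFunction lam n g → f = g`,
* hence `IsProlateFunction.existsUnique_of_exists`: existence alone gives the `∃!` of the named fact
  `existsUnique_isProlateFunction`.

## Proof (classical Sturm–Liouville theory)

1. *Sturm comparison across eigenvalues* (`sturm_gap_pos`, `IsProlateFunction.exists_zero_in_gap`):
   if `f`, `g` solve the equation with `χ_f < χ_g`, then strictly between two consecutive zeros of `f` —
   where the singular end points `±λ` count as zeros because the weight `λ² − x²` of the Wronskian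
   `W = (λ² − x²)(f g′ − f′ g)` vanishes there — lies a zero of `g`: `W′ = (χ_f − χ_g) f g` has a sign
   on the gap while `W` has the opposite signs at its ends.  With `n` zeros, `f` has `n + 1` gaps, so `g`
   has at least `n + 1` zeros (`IsProlateFunction.succ_le_of_eigen_lt`).  Hence two prolate functions
   with the same number of zeros have the same eigenvalue (`IsProlateFunction.eigen_eq`).
2. *Cauchy uniqueness*: `f′(0) = 0 = g′(0)` (`IsProlateFunction.deriv_zero`, file `ProlateParity`), so
   `f − (f(0)/g(0)) g` solves the regular linear equation on every `[−μ, μ]`, `μ < λ`, with zero Cauchy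
   data at `0`, hence vanishes (`ODE_solution_unique_of_mem_Ioo`); at `±λ` by continuity, outside by
   the support axiom (`IsProlateFunction.eq_mul_of_eigen_eq`).  The normalisations `∫ f² = ∫ g² = 1`,
   `f(0), g(0) > 0` force the constant to be `1`.

References: Sturm's comparison and oscillation theorems [Hartman 2002, Ch. XI §3 Thm 3.1, §4 Thm 4.1;
Coddington–Levinson 1955, Ch. 8, §1 Thm 1.1, Thm 1.2 and §2]; the prolate case [Slepian–Pollak 1961, §III]; the interface [Connes–Consani–Moscovici
2025, §7].  Nothing here concerns `ζ` or RH.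
-/

noncomputable section

open Real Set MeasureTheory Filter Topology intervalIntegral

namespace Literature.NumberTheory.LFunctions

/-! ### Two elementary sign lemmas for derivatives at a zero -/

/-- If `f(a) = 0`, `f` is differentiable at `a` and `f > 0` on `(a, b)`, then `f′(a) ≥ 0`. [folklore] -/
theorem hasDerivAt_nonneg_of_pos_right {f : ℝ → ℝ} {d a b : ℝ} (hd : HasDerivAt f d a)
    (hfa : f a = 0) (hab : a < b) (hpos : ∀ x ∈ Ioo a b, 0 < f x) : 0 ≤ d := by
  have ht : Tendsto (slope f a) (𝓝[>] a) (𝓝 d) :=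
    (hasDerivAt_iff_tendsto_slope_left_right.mp hd).2
  have hev : ∀ᶠ x in 𝓝[>] a, 0 ≤ slope f a x := by
    filter_upwards [Ioo_mem_nhdsGT hab] with x hx
    rw [slope_def_field, hfa, sub_zero]
    exact (div_pos (hpos x hx) (sub_pos.mpr hx.1)).le
  exact ge_of_tendsto ht hev

/-- If `f(b) = 0`, `f` is differentiable at `b` and `f > 0` on `(a, b)`, then `f′(b) ≤ 0`. [folklore] -/
theorem hasDerivAt_nonpos_of_pos_left {f : ℝ → ℝ} {d a b : ℝ} (hd : HasDerivAt f d b)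
    (hfb : f b = 0) (hab : a < b) (hpos : ∀ x ∈ Ioo a b, 0 < f x) : d ≤ 0 := by
  have ht : Tendsto (slope f b) (𝓝[<] b) (𝓝 d) :=
    (hasDerivAt_iff_tendsto_slope_left_right.mp hd).1
  have hev : ∀ᶠ x in 𝓝[<] b, slope f b x ≤ 0 := by
    filter_upwards [Ioo_mem_nhdsLT hab] with x hx
    rw [slope_def_field, hfb, sub_zero]
    exact (div_neg_of_pos_of_neg (hpos x hx) (sub_neg.mpr hx.2)).le
  exact le_of_tendsto ht hev

/-- A continuous function without zeros on an open interval has constant sign there. [folklore] -/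
theorem pos_or_neg_of_ne_zero {f : ℝ → ℝ} {a b : ℝ} (hab : a < b) (hf : ContinuousOn f (Ioo a b))
    (hz : ∀ x ∈ Ioo a b, f x ≠ 0) :
    (∀ x ∈ Ioo a b, 0 < f x) ∨ (∀ x ∈ Ioo a b, f x < 0) := by
  set c : ℝ := (a + b) / 2 with hc
  have hcm : c ∈ Ioo a b := ⟨by rw [hc]; linarith, by rw [hc]; linarith⟩
  -- intermediate values between `x` and `c`
  have key : ∀ x ∈ Ioo a b, ∀ y ∈ Ioo a b, f x < 0 → 0 < f y → False := by
    intro x hx y hy hfx hfy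
    have hsub : uIcc x y ⊆ Ioo a b := ordConnected_Ioo.uIcc_subset hx hy
    have h0 : (0 : ℝ) ∈ uIcc (f x) (f y) := by
      rw [mem_uIcc]; exact Or.inl ⟨hfx.le, hfy.le⟩
    obtain ⟨z, hz', hfz⟩ := intermediate_value_uIcc (hf.mono hsub) h0
    exact hz z (hsub hz') hfz
  rcases lt_or_gt_of_ne (hz c hcm) with hneg | hpos
  · refine Or.inr fun x hx ↦ ?_
    rcases lt_trichotomy (f x) 0 with h | h | h
    · exact h
    · exact absurd h (hz x hx)
    · exact (key c hcm x hx hneg h).elim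
  · refine Or.inl fun x hx ↦ ?_
    rcases lt_trichotomy (f x) 0 with h | h | h
    · exact (key x hx c hcm h hpos).elim
    · exact absurd h (hz x hx)
    · exact h

/-! ### The Sturm gap lemma (abstract form) -/

/-- **Sturm's comparison step.**  Let `f`, `g` be continuous on `[−λ, λ]` with continuous "derivative
functions" `f₁`, `g₁` (`f′ = f₁`, `g′ = g₁` on the open interval) such that the fluxes
`(λ² − x²) f₁`, `(λ² − x²) g₁` have derivatives `((2πλx)² − χ_f) f`, `((2πλx)² − χ_g) g` on `(−λ, λ)`
(the prolate equation in divergence form), with `χ_f < χ_g`.  If `f > 0` and `g > 0` on a gap `(a, b)`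
whose ends are zeros of `f` or singular end points `±λ`, we get a contradiction: the weighted Wronskian
`W = f·(λ²−x²)g₁ − (λ²−x²)f₁·g` satisfies `W(b) − W(a) = (χ_f − χ_g)∫_a^b f g < 0`, while
`W(a) ≤ 0 ≤ W(b)`. [cite: Hartman2002, Ch. XI §3 Thm 3.1; CoddingtonLevinson1955, Ch. 8 §1 Thm 1.1] -/
theorem sturm_gap_pos {lam χf χg a b : ℝ} {f g f₁ g₁ : ℝ → ℝ} (hχ : χf < χg)
    (hfc : ContinuousOn f (Icc (-lam) lam)) (hgc : ContinuousOn g (Icc (-lam) lam))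
    (hf₁c : ContinuousOn f₁ (Icc (-lam) lam)) (hg₁c : ContinuousOn g₁ (Icc (-lam) lam))
    (hfd : ∀ x ∈ Ioo (-lam) lam, HasDerivAt f (f₁ x) x)
    (hgd : ∀ x ∈ Ioo (-lam) lam, HasDerivAt g (g₁ x) x)
    (hfe : ∀ x ∈ Ioo (-lam) lam,
      HasDerivAt (fun y ↦ (lam ^ 2 - y ^ 2) * f₁ y) (((2 * π * lam * x) ^ 2 - χf) * f x) x)
    (hge : ∀ x ∈ Ioo (-lam) lam,
      HasDerivAt (fun y ↦ (lam ^ 2 - y ^ 2) * g₁ y) (((2 * π * lam * x) ^ 2 - χg) * g x) x)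
    (ha : -lam ≤ a) (hab : a < b) (hb : b ≤ lam)
    (hfa : a = -lam ∨ f a = 0) (hfb : b = lam ∨ f b = 0)
    (hfpos : ∀ x ∈ Ioo a b, 0 < f x) (hgpos : ∀ x ∈ Ioo a b, 0 < g x) : False := by
  set W : ℝ → ℝ := fun x ↦ f x * ((lam ^ 2 - x ^ 2) * g₁ x) - (lam ^ 2 - x ^ 2) * f₁ x * g x
    with hW
  have hIoo : Ioo a b ⊆ Ioo (-lam) lam := fun x hx ↦ ⟨by linarith [hx.1], by linarith [hx.2]⟩
  have hIcc : Icc a b ⊆ Icc (-lam) lam := fun x hx ↦ ⟨by linarith [hx.1], by linarith [hx.2]⟩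
  have hWd : ∀ x ∈ Ioo a b, HasDerivAt W ((χf - χg) * f x * g x) x := by
    intro x hx
    have hx' := hIoo hx
    have h1 : HasDerivAt (fun y ↦ f y * ((lam ^ 2 - y ^ 2) * g₁ y))
        (f₁ x * ((lam ^ 2 - x ^ 2) * g₁ x) + f x * (((2 * π * lam * x) ^ 2 - χg) * g x)) x :=
      (hfd x hx').mul (hge x hx')
    have h2 : HasDerivAt (fun y ↦ (lam ^ 2 - y ^ 2) * f₁ y * g y)
        (((2 * π * lam * x) ^ 2 - χf) * f x * g x + (lam ^ 2 - x ^ 2) * f₁ x * g₁ x) x :=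
      (hfe x hx').mul (hgd x hx')
    have h : HasDerivAt W ((f₁ x * ((lam ^ 2 - x ^ 2) * g₁ x)
        + f x * (((2 * π * lam * x) ^ 2 - χg) * g x))
        - (((2 * π * lam * x) ^ 2 - χf) * f x * g x + (lam ^ 2 - x ^ 2) * f₁ x * g₁ x)) x :=
      h1.sub h2
    exact h.congr_deriv (by ring)
  have hp : Continuous fun x : ℝ ↦ lam ^ 2 - x ^ 2 := by fun_prop
  have hWc : ContinuousOn W (Icc a b) :=
    ((hfc.mono hIcc).mul (hp.continuousOn.mul (hg₁c.mono hIcc))).sub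
      ((hp.continuousOn.mul (hf₁c.mono hIcc)).mul (hgc.mono hIcc))
  have hprod : ContinuousOn (fun x ↦ f x * g x) (Icc a b) := (hfc.mono hIcc).mul (hgc.mono hIcc)
  have hint : IntervalIntegrable (fun x ↦ (χf - χg) * f x * g x) volume a b := by
    apply ContinuousOn.intervalIntegrable
    rw [uIcc_of_le hab.le]
    exact (continuousOn_const.mul (hfc.mono hIcc)).mul (hgc.mono hIcc)
  have hftc : ∫ x in a..b, (χf - χg) * f x * g x = W b - W a :=
    integral_eq_sub_of_hasDerivAt_of_le hab.le hWc hWd hint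
  -- the integral is negative
  have hneg : ∫ x in a..b, (χf - χg) * f x * g x < 0 := by
    have hpos : 0 < ∫ x in a..b, (χg - χf) * (f x * g x) := by
      apply intervalIntegral_pos_of_pos_on
      · apply ContinuousOn.intervalIntegrable
        rw [uIcc_of_le hab.le]
        exact continuousOn_const.mul hprod
      · intro x hx
        exact mul_pos (sub_pos.mpr hχ) (mul_pos (hfpos x hx) (hgpos x hx))
      · exact hab
    have : ∫ x in a..b, (χf - χg) * f x * g x = -∫ x in a..b, (χg - χf) * (f x * g x) := by
      rw [← intervalIntegral.integral_neg]
      congr 1; ext x; ring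
    linarith
  -- `g ≥ 0` at the end points of the gap
  have hga : 0 ≤ g a := by
    haveI : (𝓝[Ioo a b] a).NeBot := left_nhdsWithin_Ioo_neBot hab
    have ht : Tendsto g (𝓝[Ioo a b] a) (𝓝 (g a)) :=
      ((hgc.continuousWithinAt (hIcc ⟨le_rfl, hab.le⟩)).mono (hIoo.trans Ioo_subset_Icc_self)).tendsto
    exact ge_of_tendsto ht (by
      filter_upwards [self_mem_nhdsWithin] with x hx using (hgpos x hx).le)
  have hgb : 0 ≤ g b := by
    haveI : (𝓝[Ioo a b] b).NeBot := right_nhdsWithin_Ioo_neBot hab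
    have ht : Tendsto g (𝓝[Ioo a b] b) (𝓝 (g b)) :=
      ((hgc.continuousWithinAt (hIcc ⟨hab.le, le_rfl⟩)).mono (hIoo.trans Ioo_subset_Icc_self)).tendsto
    exact ge_of_tendsto ht (by
      filter_upwards [self_mem_nhdsWithin] with x hx using (hgpos x hx).le)
  -- `W(a) ≤ 0`
  have hWa : W a ≤ 0 := by
    rcases ha.eq_or_lt with rfl | ha'
    · have : lam ^ 2 - (-lam) ^ 2 = 0 := by ring
      simp only [hW, this, zero_mul, mul_zero, sub_self, le_refl]
    · have hfa0 : f a = 0 := by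
        rcases hfa with h | h
        · exact absurd h (by linarith)
        · exact h
      have ham : a ∈ Ioo (-lam) lam := ⟨ha', by linarith⟩
      have hf₁a : 0 ≤ f₁ a := hasDerivAt_nonneg_of_pos_right (hfd a ham) hfa0 hab hfpos
      have hpa : 0 ≤ lam ^ 2 - a ^ 2 := by nlinarith [ham.1, ham.2]
      have : W a = -((lam ^ 2 - a ^ 2) * f₁ a * g a) := by simp only [hW, hfa0, zero_mul, zero_sub]
      rw [this, neg_nonpos]
      exact mul_nonneg (mul_nonneg hpa hf₁a) hga
  -- `0 ≤ W(b)`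
  have hWb : 0 ≤ W b := by
    rcases hb.eq_or_lt with rfl | hb'
    · have : b ^ 2 - b ^ 2 = 0 := by ring
      simp only [hW, this, zero_mul, mul_zero, sub_self, le_refl]
    · have hfb0 : f b = 0 := by
        rcases hfb with h | h
        · exact absurd h (by linarith)
        · exact h
      have hbm : b ∈ Ioo (-lam) lam := ⟨by linarith, hb'⟩
      have hf₁b : f₁ b ≤ 0 := hasDerivAt_nonpos_of_pos_left (hfd b hbm) hfb0 hab hfpos
      have hpb : 0 ≤ lam ^ 2 - b ^ 2 := by nlinarith [hbm.1, hbm.2]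
      have : W b = -((lam ^ 2 - b ^ 2) * f₁ b * g b) := by simp only [hW, hfb0, zero_mul, zero_sub]
      rw [this, neg_nonneg]
      have : (lam ^ 2 - b ^ 2) * f₁ b ≤ 0 := mul_nonpos_of_nonneg_of_nonpos hpb hf₁b
      exact mul_nonpos_of_nonpos_of_nonneg this hgb
  linarith

/-- Sturm's comparison step for functions of constant (but arbitrary) signs on the gap: reduce to
`sturm_gap_pos` by replacing `f`, `g` by `±f`, `±g`. [cite: Hartman2002, Ch. XI §3 Thm 3.1; CoddingtonLevinson1955, Ch. 8 §1 Thm 1.1] -/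
theorem sturm_gap {lam χf χg a b : ℝ} {f g f₁ g₁ : ℝ → ℝ} (hχ : χf < χg)
    (hfc : ContinuousOn f (Icc (-lam) lam)) (hgc : ContinuousOn g (Icc (-lam) lam))
    (hf₁c : ContinuousOn f₁ (Icc (-lam) lam)) (hg₁c : ContinuousOn g₁ (Icc (-lam) lam))
    (hfd : ∀ x ∈ Ioo (-lam) lam, HasDerivAt f (f₁ x) x)
    (hgd : ∀ x ∈ Ioo (-lam) lam, HasDerivAt g (g₁ x) x)
    (hfe : ∀ x ∈ Ioo (-lam) lam,
      HasDerivAt (fun y ↦ (lam ^ 2 - y ^ 2) * f₁ y) (((2 * π * lam * x) ^ 2 - χf) * f x) x)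
    (hge : ∀ x ∈ Ioo (-lam) lam,
      HasDerivAt (fun y ↦ (lam ^ 2 - y ^ 2) * g₁ y) (((2 * π * lam * x) ^ 2 - χg) * g x) x)
    (ha : -lam ≤ a) (hab : a < b) (hb : b ≤ lam)
    (hfa : a = -lam ∨ f a = 0) (hfb : b = lam ∨ f b = 0)
    (hfs : (∀ x ∈ Ioo a b, 0 < f x) ∨ (∀ x ∈ Ioo a b, f x < 0))
    (hgs : (∀ x ∈ Ioo a b, 0 < g x) ∨ (∀ x ∈ Ioo a b, g x < 0)) : False := by
  -- negation preserves all the hypotheses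
  have negd : ∀ {u u₁ : ℝ → ℝ} {χ : ℝ}, (∀ x ∈ Ioo (-lam) lam, HasDerivAt u (u₁ x) x) →
      (∀ x ∈ Ioo (-lam) lam,
        HasDerivAt (fun y ↦ (lam ^ 2 - y ^ 2) * u₁ y) (((2 * π * lam * x) ^ 2 - χ) * u x) x) →
      (∀ x ∈ Ioo (-lam) lam, HasDerivAt (fun y ↦ -u y) ((fun y ↦ -u₁ y) x) x) ∧
      (∀ x ∈ Ioo (-lam) lam,
        HasDerivAt (fun y ↦ (lam ^ 2 - y ^ 2) * (fun y ↦ -u₁ y) y)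
          (((2 * π * lam * x) ^ 2 - χ) * (fun y ↦ -u y) x) x) := by
    intro u u₁ χ hu hue
    refine ⟨fun x hx ↦ (hu x hx).neg, fun x hx ↦ ?_⟩
    have h := (hue x hx).neg
    refine (h.congr_of_eventuallyEq (Eventually.of_forall fun y ↦ ?_)).congr_deriv ?_
    · simp only [mul_neg, Pi.neg_apply]
    · ring
  have hfan : ∀ {u : ℝ → ℝ}, (a = -lam ∨ u a = 0) → (a = -lam ∨ (fun y ↦ -u y) a = 0) := by
    intro u h; rcases h with h | h
    · exact Or.inl h
    · exact Or.inr (by simp [h])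
  have hfbn : ∀ {u : ℝ → ℝ}, (b = lam ∨ u b = 0) → (b = lam ∨ (fun y ↦ -u y) b = 0) := by
    intro u h; rcases h with h | h
    · exact Or.inl h
    · exact Or.inr (by simp [h])
  rcases hfs with hfp | hfn <;> rcases hgs with hgp | hgn
  · exact sturm_gap_pos hχ hfc hgc hf₁c hg₁c hfd hgd hfe hge ha hab hb hfa hfb hfp hgp
  · obtain ⟨hgd', hge'⟩ := negd hgd hge
    exact sturm_gap_pos hχ hfc hgc.neg hf₁c hg₁c.neg hfd hgd' hfe hge' ha hab hb hfa hfb hfp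
      (fun x hx ↦ by simpa using hgn x hx)
  · obtain ⟨hfd', hfe'⟩ := negd hfd hfe
    exact sturm_gap_pos hχ hfc.neg hgc hf₁c.neg hg₁c hfd' hgd hfe' hge ha hab hb (hfan hfa)
      (hfbn hfb) (fun x hx ↦ by simpa using hfn x hx) hgp
  · obtain ⟨hfd', hfe'⟩ := negd hfd hfe
    obtain ⟨hgd', hge'⟩ := negd hgd hge
    exact sturm_gap_pos hχ hfc.neg hgc.neg hf₁c.neg hg₁c.neg hfd' hgd' hfe' hge' ha hab hb
      (hfan hfa) (hfbn hfb) (fun x hx ↦ by simpa using hfn x hx)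
      (fun x hx ↦ by simpa using hgn x hx)

/-! ### Prolate functions: the comparison, the eigenvalue, uniqueness -/

namespace IsProlateFunction

variable {lam : ℝ} {n m : ℕ} {f g : ℝ → ℝ}

/-- On the open interval the one-sided derivative is the derivative.
[cite: ConnesConsaniMoscovici2025, §7 eq. (7.5)] -/
theorem hasDerivAt_derivWithin (hf : IsProlateFunction lam n f) {x : ℝ} (hx : x ∈ Ioo (-lam) lam) :
    HasDerivAt f (derivWithin f (Icc (-lam) lam) x) x := by
  rw [derivWithin_of_mem_nhds (Icc_mem_nhds hx.1 hx.2)]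
  exact (hf.differentiableAt hx).hasDerivAt

/-- The prolate equation in divergence form, with the flux written with the one-sided derivative:
`((λ² − x²) f₁)′ = ((2πλx)² − χ) f` on `(−λ, λ)`. [cite: ConnesConsaniMoscovici2025, §7 eq. (7.5)] -/
theorem hasDerivAt_flux (hf : IsProlateFunction lam n f) {χ : ℝ}
    (hχ : ∀ x ∈ Ioo (-lam) lam,
      -(deriv (fun y ↦ (lam ^ 2 - y ^ 2) * deriv f y) x) + (2 * π * lam * x) ^ 2 * f x = χ * f x)
    {x : ℝ} (hx : x ∈ Ioo (-lam) lam) :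
    HasDerivAt (fun y ↦ (lam ^ 2 - y ^ 2) * derivWithin f (Icc (-lam) lam) y)
      (((2 * π * lam * x) ^ 2 - χ) * f x) x := by
  have hp : HasDerivAt (fun y : ℝ ↦ lam ^ 2 - y ^ 2) (-(2 * x)) x := by
    simpa using (hasDerivAt_pow 2 x).const_sub (lam ^ 2)
  have hd : HasDerivAt (deriv f) (deriv (deriv f) x) x := (hf.differentiableAt_deriv hx).hasDerivAt
  have h1 : HasDerivAt (fun y ↦ (lam ^ 2 - y ^ 2) * deriv f y)
      (deriv (fun y ↦ (lam ^ 2 - y ^ 2) * deriv f y) x) x :=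
    (hp.mul hd).differentiableAt.hasDerivAt
  have h2 : deriv (fun y ↦ (lam ^ 2 - y ^ 2) * deriv f y) x = ((2 * π * lam * x) ^ 2 - χ) * f x := by
    linear_combination -(hχ x hx)
  rw [← h2]
  refine h1.congr_of_eventuallyEq ?_
  filter_upwards [isOpen_Ioo.mem_nhds hx] with y hy
  rw [derivWithin_of_mem_nhds (Icc_mem_nhds hy.1 hy.2)]

/-- The prolate equation solved for `f″`, for a GIVEN eigenvalue `χ` (cf. `IsProlateFunction.ode`).
[cite: ConnesConsaniMoscovici2025, §7 eq. (7.5)] -/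
theorem ode_of_eigen (hf : IsProlateFunction lam n f) {χ : ℝ}
    (hχ : ∀ x ∈ Ioo (-lam) lam,
      -(deriv (fun y ↦ (lam ^ 2 - y ^ 2) * deriv f y) x) + (2 * π * lam * x) ^ 2 * f x = χ * f x) :
    ∀ x ∈ Ioo (-lam) lam,
      (lam ^ 2 - x ^ 2) * deriv (deriv f) x = 2 * x * deriv f x + ((2 * π * lam * x) ^ 2 - χ) * f x := by
  intro x hx
  have hp : HasDerivAt (fun y : ℝ ↦ lam ^ 2 - y ^ 2) (-(2 * x)) x := by
    simpa using (hasDerivAt_pow 2 x).const_sub (lam ^ 2)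
  have hd : HasDerivAt (deriv f) (deriv (deriv f) x) x := (hf.differentiableAt_deriv hx).hasDerivAt
  have e' : deriv (fun y ↦ (lam ^ 2 - y ^ 2) * deriv f y) x
      = -(2 * x) * deriv f x + (lam ^ 2 - x ^ 2) * deriv (deriv f) x := (hp.mul hd).deriv
  have e := hχ x hx
  rw [e'] at e
  linear_combination -e

/-- **Sturm comparison for prolate functions.**  If `f = h_{n,λ}` and `g = h_{m,λ}` have eigenvalues
`χ_f < χ_g`, then every gap `(a, b)` of `f` — no zeros of `f` inside, each end a zero of `f` or a singular
end point `±λ` — contains a zero of `g`. [cite: Hartman2002, Ch. XI §3 Thm 3.1;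
CoddingtonLevinson1955, Ch. 8 §1 Thm 1.1; SlepianPollak1961, §III] -/
theorem exists_zero_in_gap (hf : IsProlateFunction lam n f) (hg : IsProlateFunction lam m g)
    {χf χg : ℝ}
    (hχf : ∀ x ∈ Ioo (-lam) lam,
      -(deriv (fun y ↦ (lam ^ 2 - y ^ 2) * deriv f y) x) + (2 * π * lam * x) ^ 2 * f x = χf * f x)
    (hχg : ∀ x ∈ Ioo (-lam) lam,
      -(deriv (fun y ↦ (lam ^ 2 - y ^ 2) * deriv g y) x) + (2 * π * lam * x) ^ 2 * g x = χg * g x)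
    (hlt : χf < χg) {a b : ℝ} (ha : -lam ≤ a) (hab : a < b) (hb : b ≤ lam)
    (hfa : a = -lam ∨ f a = 0) (hfb : b = lam ∨ f b = 0) (hfz : ∀ x ∈ Ioo a b, f x ≠ 0) :
    ∃ z ∈ Ioo a b, g z = 0 := by
  by_contra hcon
  push Not at hcon
  have hIoo : Ioo a b ⊆ Ioo (-lam) lam := fun x hx ↦ ⟨by linarith [hx.1], by linarith [hx.2]⟩
  have hfs := pos_or_neg_of_ne_zero hab
    (hf.contDiffOn.continuousOn.mono (hIoo.trans Ioo_subset_Icc_self)) hfz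
  have hgs := pos_or_neg_of_ne_zero hab
    (hg.contDiffOn.continuousOn.mono (hIoo.trans Ioo_subset_Icc_self)) hcon
  exact sturm_gap hlt hf.contDiffOn.continuousOn hg.contDiffOn.continuousOn
    hf.continuousOn_derivWithin hg.continuousOn_derivWithin
    (fun x hx ↦ hf.hasDerivAt_derivWithin hx) (fun x hx ↦ hg.hasDerivAt_derivWithin hx)
    (fun x hx ↦ hf.hasDerivAt_flux hχf hx) (fun x hx ↦ hg.hasDerivAt_flux hχg hx)
    ha hab hb hfa hfb hfs hgs

/-- **Sturm's count.**  If `h_{n,λ}` has eigenvalue `χ_f` and `h_{m,λ}` has eigenvalue `χ_g > χ_f`, then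
`m ≥ n + 1`: the `n` zeros of `f` and the end point `−λ` start `n + 1` disjoint gaps, each containing a
zero of `g`. [cite: Hartman2002, Ch. XI §4 Thm 4.1; CoddingtonLevinson1955, Ch. 8 §2 Thm 2.1;
SlepianPollak1961, §III] -/
theorem succ_le_of_eigen_lt (hf : IsProlateFunction lam n f) (hg : IsProlateFunction lam m g)
    {χf χg : ℝ}
    (hχf : ∀ x ∈ Ioo (-lam) lam,
      -(deriv (fun y ↦ (lam ^ 2 - y ^ 2) * deriv f y) x) + (2 * π * lam * x) ^ 2 * f x = χf * f x)
    (hχg : ∀ x ∈ Ioo (-lam) lam,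
      -(deriv (fun y ↦ (lam ^ 2 - y ^ 2) * deriv g y) x) + (2 * π * lam * x) ^ 2 * g x = χg * g x)
    (hlt : χf < χg) : n + 1 ≤ m := by
  have hlam := hf.lam_pos
  set Zf : Set ℝ := {x | x ∈ Ioo (-lam) lam ∧ f x = 0} with hZf
  set Zg : Set ℝ := {x | x ∈ Ioo (-lam) lam ∧ g x = 0} with hZg
  have hZff : Zf.Finite := hf.zeros_finite
  have hZgf : Zg.Finite := hg.zeros_finite
  -- the left ends of the gaps
  set E : Set ℝ := insert (-lam) Zf with hE
  have hEcard : E.ncard = n + 1 := by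
    rw [hE, ncard_insert_of_notMem (fun h ↦ by have := h.1.1; linarith) hZff, hf.zeros_card]
  have hElt : ∀ e ∈ E, e < lam ∧ -lam ≤ e := by
    intro e he
    rcases he with rfl | he
    · exact ⟨by linarith, le_rfl⟩
    · exact ⟨he.1.2, he.1.1.le⟩
  -- the right end of the gap starting at `e`
  set S : ℝ → Set ℝ := fun e ↦ {z | z ∈ Zf ∧ e < z} ∪ {lam} with hS
  have hSf : ∀ e, (S e).Finite := fun e ↦ (hZff.subset (fun z hz ↦ hz.1)).union (finite_singleton _)
  have hSn : ∀ e, (S e).Nonempty := fun e ↦ ⟨lam, Or.inr rfl⟩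
  set nxt : ℝ → ℝ := fun e ↦ sInf (S e) with hnxt
  have hnxt_mem : ∀ e, nxt e ∈ S e := fun e ↦ (hSn e).csInf_mem (hSf e)
  have hnxt_le : ∀ e, ∀ z ∈ S e, nxt e ≤ z := fun e z hz ↦ csInf_le (hSf e).bddBelow hz
  have hnxt_gt : ∀ e ∈ E, e < nxt e := by
    intro e he
    rcases hnxt_mem e with h | h
    · exact h.2
    · rw [h]; exact (hElt e he).1
  have hnxt_lam : ∀ e, nxt e ≤ lam := fun e ↦ hnxt_le e lam (Or.inr rfl)
  have hnxt_end : ∀ e, nxt e = lam ∨ f (nxt e) = 0 := by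
    intro e
    rcases hnxt_mem e with h | h
    · exact Or.inr h.1.2
    · exact Or.inl h
  have hgap : ∀ e ∈ E, ∀ x ∈ Ioo e (nxt e), f x ≠ 0 := by
    intro e he x hx hfx
    have hxZ : x ∈ Zf := ⟨⟨by linarith [(hElt e he).2, hx.1], by linarith [hnxt_lam e, hx.2]⟩, hfx⟩
    have := hnxt_le e x (Or.inl ⟨hxZ, hx.1⟩)
    linarith [hx.2]
  have hstart : ∀ e ∈ E, e = -lam ∨ f e = 0 := by
    intro e he
    rcases he with rfl | he
    · exact Or.inl rfl
    · exact Or.inr he.2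
  -- a zero of `g` in each gap
  have hex : ∀ e ∈ E, ∃ z ∈ Ioo e (nxt e), g z = 0 := fun e he ↦
    hf.exists_zero_in_gap hg hχf hχg hlt (hElt e he).2 (hnxt_gt e he) (hnxt_lam e) (hstart e he)
      (hnxt_end e) (hgap e he)
  choose! z hz using hex
  have hzZg : ∀ e ∈ E, z e ∈ Zg := by
    intro e he
    obtain ⟨hze, hgz⟩ := hz e he
    exact ⟨⟨by linarith [(hElt e he).2, hze.1], by linarith [hnxt_lam e, hze.2]⟩, hgz⟩
  -- consecutive gaps are disjoint, so `z` is injective on `E`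
  have hmono : ∀ e₁ ∈ E, ∀ e₂ ∈ E, e₁ < e₂ → z e₁ < z e₂ := by
    intro e₁ he₁ e₂ he₂ hlt'
    have h2Z : e₂ ∈ Zf := by
      rcases he₂ with h | h
      · exfalso; linarith [(hElt e₁ he₁).2]
      · exact h
    have hn : nxt e₁ ≤ e₂ := hnxt_le e₁ e₂ (Or.inl ⟨h2Z, hlt'⟩)
    linarith [(hz e₁ he₁).1.2, (hz e₂ he₂).1.1]
  have hinj : InjOn z E := by
    intro e₁ he₁ e₂ he₂ heq
    by_contra hne
    rcases lt_or_gt_of_ne hne with h | h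
    · exact absurd heq (hmono e₁ he₁ e₂ he₂ h).ne
    · exact absurd heq (hmono e₂ he₂ e₁ he₁ h).ne'
  have hle : E.ncard ≤ Zg.ncard := ncard_le_ncard_of_injOn z hzZg hinj hZgf
  rw [hEcard, hZg, hg.zeros_card] at hle
  exact hle

/-- **Zero count determines the eigenvalue.**  Two prolate functions `h_{n,λ}` (same `λ`, same number
of zeros `n`) have the same eigenvalue `χ`. [cite: Hartman2002, Ch. XI §4 Thm 4.1;
CoddingtonLevinson1955, Ch. 8 §2 Thm 2.1; SlepianPollak1961, §III] -/
theorem eigen_eq (hf : IsProlateFunction lam n f) (hg : IsProlateFunction lam n g) {χf χg : ℝ}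
    (hχf : ∀ x ∈ Ioo (-lam) lam,
      -(deriv (fun y ↦ (lam ^ 2 - y ^ 2) * deriv f y) x) + (2 * π * lam * x) ^ 2 * f x = χf * f x)
    (hχg : ∀ x ∈ Ioo (-lam) lam,
      -(deriv (fun y ↦ (lam ^ 2 - y ^ 2) * deriv g y) x) + (2 * π * lam * x) ^ 2 * g x = χg * g x) :
    χf = χg := by
  rcases lt_trichotomy χf χg with h | h | h
  · have := hf.succ_le_of_eigen_lt hg hχf hχg h; omega
  · exact h
  · have := hg.succ_le_of_eigen_lt hf hχg hχf h; omega

/-- **Cauchy uniqueness at the regular point `0`.**  Two prolate functions (any numbers of zeros) with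
the SAME eigenvalue are proportional: `f = (f(0)/g(0)) · g` everywhere — on `(−λ, λ)` because
`f′(0) = g′(0) = 0` (`IsProlateFunction.deriv_zero`) and the Cauchy problem for the regular linear
equation on `[−μ, μ]`, `μ < λ`, has a unique solution; at `±λ` by continuity; outside by the support
axiom. [cite: CoddingtonLevinson1955, Ch. 1 §7 & Ch. 8 §1; SlepianPollak1961, §III] -/
theorem eq_mul_of_eigen_eq (hf : IsProlateFunction lam n f) (hg : IsProlateFunction lam m g) {χ : ℝ}
    (hχf : ∀ x ∈ Ioo (-lam) lam,
      -(deriv (fun y ↦ (lam ^ 2 - y ^ 2) * deriv f y) x) + (2 * π * lam * x) ^ 2 * f x = χ * f x)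
    (hχg : ∀ x ∈ Ioo (-lam) lam,
      -(deriv (fun y ↦ (lam ^ 2 - y ^ 2) * deriv g y) x) + (2 * π * lam * x) ^ 2 * g x = χ * g x) :
    ∀ x, f x = (f 0 / g 0) * g x := by
  have hlam := hf.lam_pos
  have hodef := hf.ode_of_eigen hχf
  have hodeg := hg.ode_of_eigen hχg
  set c : ℝ := f 0 / g 0 with hc
  have hg0 : g 0 ≠ 0 := hg.pos_zero.ne'
  -- the difference `h = f − c g`
  set h : ℝ → ℝ := fun x ↦ f x - c * g x with hh
  have hh0 : h 0 = 0 := by simp only [hh, hc]; field_simp; ring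
  have hdh : ∀ x ∈ Ioo (-lam) lam, HasDerivAt h (deriv f x - c * deriv g x) x := fun x hx ↦
    ((hf.differentiableAt hx).hasDerivAt).sub (((hg.differentiableAt hx).hasDerivAt).const_mul c)
  have hderiv_h : ∀ x ∈ Ioo (-lam) lam, deriv h x = deriv f x - c * deriv g x :=
    fun x hx ↦ (hdh x hx).deriv
  have hdh' : ∀ x ∈ Ioo (-lam) lam,
      HasDerivAt (fun y ↦ deriv f y - c * deriv g y)
        (deriv (deriv f) x - c * deriv (deriv g) x) x := fun x hx ↦
    ((hf.differentiableAt_deriv hx).hasDerivAt).sub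
      (((hg.differentiableAt_deriv hx).hasDerivAt).const_mul c)
  -- interior: ODE uniqueness on `(−μ, μ)`
  have hin : ∀ x ∈ Ioo (-lam) lam, h x = 0 := by
    intro x hx
    set μ : ℝ := (|x| + lam) / 2 with hμ
    have hxabs : |x| < lam := abs_lt.mpr ⟨hx.1, hx.2⟩
    have hμlam : μ < lam := by rw [hμ]; linarith
    have hμpos : 0 < μ := by rw [hμ]; linarith [abs_nonneg x]
    have hxμ : x ∈ Ioo (-μ) μ := by
      rw [hμ]; constructor <;> cases abs_lt.mp (show |x| < (|x| + lam) / 2 by linarith) <;> linarith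
    have hsub : Ioo (-μ) μ ⊆ Ioo (-lam) lam := Ioo_subset_Ioo (by linarith) hμlam.le
    let v : ℝ → ℝ × ℝ → ℝ × ℝ := fun t Y ↦
      (Y.2, (2 * t * Y.2 + ((2 * π * lam * t) ^ 2 - χ) * Y.1) / (lam ^ 2 - t ^ 2))
    set L : ℝ := (2 * lam + ((2 * π * lam * lam) ^ 2 + |χ|)) / (lam ^ 2 - μ ^ 2) + 1 with hL
    have hden : 0 < lam ^ 2 - μ ^ 2 := by nlinarith
    have hLpos : 0 < L := by rw [hL]; positivity
    have hv : ∀ t ∈ Ioo (-μ) μ, LipschitzOnWith (Real.toNNReal L) (v t) univ := by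
      intro t ht
      have htabs : |t| < μ := abs_lt.mpr ⟨ht.1, ht.2⟩
      have hpt : lam ^ 2 - μ ^ 2 ≤ lam ^ 2 - t ^ 2 := by nlinarith [abs_nonneg t, sq_abs t]
      have hpt0 : 0 < lam ^ 2 - t ^ 2 := lt_of_lt_of_le hden hpt
      refine (LipschitzWith.of_dist_le_mul fun Y Z ↦ ?_).lipschitzOnWith
      rw [Real.coe_toNNReal _ hLpos.le]
      have hd1 : dist Y.1 Z.1 ≤ dist Y Z := by rw [Prod.dist_eq]; exact le_max_left _ _
      have hd2 : dist Y.2 Z.2 ≤ dist Y Z := by rw [Prod.dist_eq]; exact le_max_right _ _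
      rw [Real.dist_eq] at hd1 hd2
      have hdYZ : 0 ≤ dist Y Z := dist_nonneg
      rw [Prod.dist_eq]
      refine max_le ?_ ?_
      · rw [Real.dist_eq]
        calc |Y.2 - Z.2| ≤ dist Y Z := hd2
          _ = 1 * dist Y Z := (one_mul _).symm
          _ ≤ L * dist Y Z := by
              gcongr; rw [hL]
              linarith [show 0 ≤ (2 * lam + ((2 * π * lam * lam) ^ 2 + |χ|)) / (lam ^ 2 - μ ^ 2) by
                positivity]
      · rw [Real.dist_eq, ← sub_div, abs_div, abs_of_pos hpt0]
        have hcoef1 : |2 * t| ≤ 2 * lam := by rw [abs_mul, abs_two]; linarith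
        have hcoef2 : |(2 * π * lam * t) ^ 2 - χ| ≤ (2 * π * lam * lam) ^ 2 + |χ| := by
          refine (abs_sub _ _).trans (add_le_add ?_ le_rfl)
          rw [abs_pow, pow_le_pow_iff_left₀ (abs_nonneg _) (by positivity) two_ne_zero, abs_mul,
            abs_of_pos (by positivity : 0 < 2 * π * lam)]
          exact mul_le_mul_of_nonneg_left (by linarith) (by positivity)
        have hnum : |2 * t * Y.2 + ((2 * π * lam * t) ^ 2 - χ) * Y.1
              - (2 * t * Z.2 + ((2 * π * lam * t) ^ 2 - χ) * Z.1)|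
            ≤ (2 * lam + ((2 * π * lam * lam) ^ 2 + |χ|)) * dist Y Z := by
          have e : 2 * t * Y.2 + ((2 * π * lam * t) ^ 2 - χ) * Y.1
              - (2 * t * Z.2 + ((2 * π * lam * t) ^ 2 - χ) * Z.1)
              = 2 * t * (Y.2 - Z.2) + ((2 * π * lam * t) ^ 2 - χ) * (Y.1 - Z.1) := by ring
          rw [e]
          refine (abs_add_le _ _).trans ?_
          rw [abs_mul (2 * t), abs_mul ((2 * π * lam * t) ^ 2 - χ), add_mul]
          exact add_le_add (mul_le_mul hcoef1 hd2 (abs_nonneg _) (by linarith))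
            (mul_le_mul hcoef2 hd1 (abs_nonneg _) (by positivity))
        calc |2 * t * Y.2 + ((2 * π * lam * t) ^ 2 - χ) * Y.1
                - (2 * t * Z.2 + ((2 * π * lam * t) ^ 2 - χ) * Z.1)| / (lam ^ 2 - t ^ 2)
            ≤ (2 * lam + ((2 * π * lam * lam) ^ 2 + |χ|)) * dist Y Z / (lam ^ 2 - μ ^ 2) := by
              gcongr
          _ = ((2 * lam + ((2 * π * lam * lam) ^ 2 + |χ|)) / (lam ^ 2 - μ ^ 2)) * dist Y Z := by
              ring
          _ ≤ L * dist Y Z := by gcongr; rw [hL]; linarith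
    -- the solution `(h, h′)` and the zero solution
    have hY : ∀ t ∈ Ioo (-μ) μ,
        HasDerivAt (fun s ↦ (h s, deriv f s - c * deriv g s))
          (v t (h t, deriv f t - c * deriv g t)) t
          ∧ (h t, deriv f t - c * deriv g t) ∈ univ := by
      intro t ht
      have ht' := hsub ht
      have hpt0 : lam ^ 2 - t ^ 2 ≠ 0 := by
        have : |t| < lam := abs_lt.mpr ⟨ht'.1, ht'.2⟩; nlinarith [abs_nonneg t, sq_abs t]
      refine ⟨?_, mem_univ _⟩
      have hd := (hdh t ht').prodMk (hdh' t ht')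
      convert hd using 2
      rw [div_eq_iff hpt0]
      have e1 := hodef t ht'
      have e2 := hodeg t ht'
      simp only [hh]
      linear_combination -e1 + c * e2
    have hZ : ∀ t ∈ Ioo (-μ) μ,
        HasDerivAt (fun _ : ℝ ↦ ((0 : ℝ), (0 : ℝ))) (v t ((0 : ℝ), (0 : ℝ))) t
          ∧ ((0 : ℝ), (0 : ℝ)) ∈ univ := by
      intro t ht
      refine ⟨?_, mem_univ _⟩
      have : v t ((0 : ℝ), (0 : ℝ)) = ((0 : ℝ), (0 : ℝ)) := by
        simp only [v, mul_zero, add_zero, zero_div]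
      rw [this]
      exact hasDerivAt_const t _
    have h0μ : (0 : ℝ) ∈ Ioo (-μ) μ := ⟨by linarith, hμpos⟩
    have heq : (fun s ↦ (h s, deriv f s - c * deriv g s)) 0 = (fun _ : ℝ ↦ ((0 : ℝ), (0 : ℝ))) 0 := by
      simp only [hh0, hf.deriv_zero, hg.deriv_zero, mul_zero, sub_zero]
    have hE := ODE_solution_unique_of_mem_Ioo hv h0μ hY hZ heq hxμ
    have := congrArg Prod.fst hE
    simpa using this
  -- conclusion on `(−λ, λ)`
  have hin' : ∀ x ∈ Ioo (-lam) lam, f x = c * g x := fun x hx ↦ by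
    have := hin x hx; simp only [hh] at this; linarith
  -- the end points by continuity from inside
  have hcf : ContinuousOn f (Icc (-lam) lam) := hf.contDiffOn.continuousOn
  have hcg : ContinuousOn (fun x ↦ c * g x) (Icc (-lam) lam) :=
    continuousOn_const.mul hg.contDiffOn.continuousOn
  have hclos : closure (Ioo (-lam) lam) = Icc (-lam) lam := closure_Ioo (by linarith)
  have hend : ∀ x ∈ Icc (-lam) lam, f x = c * g x := by
    intro x hx
    have hx' : x ∈ closure (Ioo (-lam) lam) := by rw [hclos]; exact hx
    haveI : (𝓝[Ioo (-lam) lam] x).NeBot := mem_closure_iff_nhdsWithin_neBot.mp hx'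
    have T1 : Tendsto f (𝓝[Ioo (-lam) lam] x) (𝓝 (f x)) :=
      ((hcf.continuousWithinAt hx).mono Ioo_subset_Icc_self).tendsto
    have T2 : Tendsto (fun t ↦ c * g t) (𝓝[Ioo (-lam) lam] x) (𝓝 (c * g x)) :=
      ((hcg.continuousWithinAt hx).mono Ioo_subset_Icc_self).tendsto
    have hev : f =ᶠ[𝓝[Ioo (-lam) lam] x] fun t ↦ c * g t := by
      filter_upwards [self_mem_nhdsWithin] with t ht using hin' t ht
    exact tendsto_nhds_unique (T1.congr' hev) T2
  intro x
  by_cases hx : x ∈ Icc (-lam) lam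
  · exact hend x hx
  · have hx' : lam < |x| := by
      rw [mem_Icc, not_and_or, not_le, not_le] at hx
      rcases hx with h | h
      · rw [abs_of_neg (by linarith)]; linarith
      · exact lt_of_lt_of_le h (le_abs_self x)
    rw [hf.support x hx', hg.support x hx', mul_zero]

/-- **Uniqueness of `h_{n,λ}`.**  The axioms of `IsProlateFunction lam n` are satisfied by at most one
function: the number of zeros fixes the eigenvalue (Sturm), the eigenvalue fixes the function up to a
scalar (Cauchy uniqueness at `0`), and `∫ f² = 1`, `f(0) > 0` fix the scalar.
[cite: SlepianPollak1961, §III; CoddingtonLevinson1955, Ch. 8 §2; ConnesConsaniMoscovici2025, §7 (7.10)–(7.12)] -/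
theorem unique (hf : IsProlateFunction lam n f) (hg : IsProlateFunction lam n g) : f = g := by
  obtain ⟨χf, hχf⟩ := hf.eigen
  obtain ⟨χg, hχg⟩ := hg.eigen
  have hχ : χf = χg := hf.eigen_eq hg hχf hχg
  subst hχ
  have hprop := hf.eq_mul_of_eigen_eq hg hχf hχg
  set c : ℝ := f 0 / g 0 with hc
  have hcpos : 0 < c := div_pos hf.pos_zero hg.pos_zero
  -- `c² = 1` from the normalisations
  have hnormf := hf.norm_one
  have hsq : ∀ x, f x ^ 2 = c ^ 2 * g x ^ 2 := fun x ↦ by rw [hprop x]; ring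
  simp_rw [hsq] at hnormf
  rw [intervalIntegral.integral_const_mul, hg.norm_one, mul_one] at hnormf
  have hc1 : c = 1 := by
    have : (c - 1) * (c + 1) = 0 := by nlinarith
    rcases mul_eq_zero.mp this with h | h
    · linarith
    · linarith
  funext x
  rw [hprop x, hc1, one_mul]

/-- Existence of `h_{n,λ}` already gives existence-and-uniqueness (the `∃!` of the named fact
`existsUnique_isProlateFunction`). [cite: SlepianPollak1961, §III; ConnesConsaniMoscovici2025, §7 (7.9)–(7.12)] -/
theorem existsUnique_of_exists (h : ∃ f, IsProlateFunction lam n f) : ∃! f, IsProlateFunction lam n f := by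
  obtain ⟨f, hf⟩ := h
  exact ⟨f, hf, fun g hg ↦ hg.unique hf⟩

end IsProlateFunction

end Literature.NumberTheory.LFunctions
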